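import Summits.ResolutionOfSingularities.ResolutionOfSingularities.Theorems.FrobeniusClosingPatchingRelPerfectDepthWeightedCleanupSNC
import Summits.ResolutionOfSingularities.ResolutionOfSingularities.Theorems.FrobeniusClosingPatchingRelPerfectDepthOneRegularizeSupport
import Summits.ResolutionOfSingularities.ResolutionOfSingularities.Theorems.FrobeniusClosingPatchingRelPerfectDepthWeightedSeqTransport
import HarnessLib

/-!
# Crux `PatchingRelPerfect` (stmt-ResolutionOfSingularities-16161), chain W5.2 — rung R4 E-side, target W₂
# `DepthTargets.WeightTwoPrincipal₃` CLOSED BY NAME (Phase A: CJS transport with weight one; Phase B: snc cleanup, weight two)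

[OURS · L1 W5.2 · TargetsF2 (b)] plan-1 g6 FILED + STEER (TargetsF2) 05:26:19Z (b), swap ratified 05:42:24Z
(W₂ := res-type-003). The target `WeightTwoPrincipal₃` (`…DepthTargetsWeightedDefs`, p502025): modulo CJS 2020 Thm. 1.4
WITH BOUNDARY (F-32bR `CossartJannsenSaito2020EmbeddedSequenceB`, a hypothesis INSIDE the statement), every non-zero
locally principal ideal sheaf `𝔟` on an integral Noetherian regular excellent scheme `E` of dimension three is carried
by a weighted sequence with weights `≤ 2` to an ideal of ORDER `≤ 1` EVERYWHERE on an integral Noetherian regular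
scheme. This file proves the two phases, their junction, and the by-name closure `DepthTargets.weightTwoPrincipal₃_holds`
(append the two sequences, `IsWeightedSeq.append_pure`, and transport integrality / Noetherianity / regularity along the
pure phase with res-D-pv-009's `IsWeightedSeq.isIntegral / .isNoetherian' / .isRegular`, `…DepthWeightedSeqTransport`).

* PHASE A (`DepthWeightTwo.phaseA`) — CJS `𝓑`-permissible sequence of `X = (Supp 𝔟)_red ⊂ E` with empty boundary,
  transported by res-type-049's generic `DepthOneRegularize.transport` (p496841) with the sequence predicate
  `IsWeightedSeq 2` and WEIGHT ONE at every step (`𝔟_j ≤ 𝓘(X_j) ≤ C_j` because the strict transform `X_j` lies in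
  `Supp 𝔟_j`; weight `1 ≤ 1 ≤ 2` is permitted by `IsWeightedSeq 2`): end state `Z₁` regular, `𝔟₁` effective Cartier,
  `≠ ⊥`, `Supp 𝔟₁ ⊆ π⁻¹(Supp 𝔟) = X₁ ∪ B₁` a STRICT NORMAL CROSSINGS DIVISOR (`X₁ ⋔ B₁`, CJS Cor. 1.5;
  `IsTransversalWith.isStrictNormalCrossingsDivisor_union`). REMARK (weights): the STEER's maximal-weight choice
  `ν_j = min (2, ord_{Z_j} 𝔟_j)` (weight `2` on centres inside the order-`2` locus, via `orderPermissible_holds`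
  p502511) is a refinement producing the same typed end state with fewer weight-deficient steps; it is NOT needed for
  the target as typed and is not used here.
* PHASE B = res-D-pv-054's `DepthTargets.weightedCleanupSNC_holds 2` (p502952) on `X₁ ∪ B₁`: a PURE weight-`2`
  sequence to `idealOrder < 2`, i.e. `≤ 1`, everywhere.
* `DepthWeightTwo.phases` — both phases in one existential (the junction state `(Z₁, 𝔟₁)` exposed: integral,
  Noetherian, regular, `𝔟₁ ≠ ⊥`);
* `DepthTargets.weightTwoPrincipal₃_holds : WeightTwoPrincipal₃` — THE TARGET BY NAME.

NOT a corollary of non-embedded resolution; NOT a statement of the manuscript under review; the CJS fact enters only as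
a hypothesis. AI-written; AI review is weaker than expert review.

## References
* V. Cossart, U. Jannsen, S. Saito, *Desingularization: Invariants and Strategy*, LNM 2270 (2020), Thm. 1.4,
  Cor. 1.5, (6.2), Def. 6.8, Thm. 6.9 (a). [CossartJannsenSaito2020]
* J. Kollár, *Lectures on Resolution of Singularities* (2007), (3.111) Step 3, 3.30.2. [Kollar2007]
* E. Bierstone, D. Grigoriev, P. Milman, J. Włodarczyk (2011), Def. 3.1.3, §3.2. [BierstoneGrigorievMilmanWlodarczyk2011]
* The Stacks Project, Tags 0BI9, 0BIA. [StacksProject]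
-/

-- `Summit.<Summit>.<Sub>.Theorems` with `Sub = Summit` (single-conjunct summit, D-0017)
set_option linter.dupNamespace false

noncomputable section

open CategoryTheory CategoryTheory.Limits AlgebraicGeometry TopologicalSpace
open Literature.AlgebraicGeometry.Resolution Scheme.IdealSheafData

namespace Summit.ResolutionOfSingularities.ResolutionOfSingularities.Theorems

universe u

namespace DepthWeightTwo

open DepthTargets

/-- The weighted-sequence predicate `IsWeightedSeq 2` is closed under WEIGHT-ONE steps (the `hcons` shape of
`DepthOneRegularize.transport`: `𝔟' ≤ C = C ^ 1`, `𝔟'𝒪 = C𝒪 · 𝔟'' = (C𝒪) ^ 1 · 𝔟''`).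
[cite: BierstoneGrigorievMilmanWlodarczyk2011, Def. 3.1.3, §3.2] -/
theorem isWeightedSeq_two_cons_one ⦃E'' E' E : Scheme.{u}⦄ (τ : E'' ⟶ E') (ρ : E' ⟶ E)
    (𝔟 : E.IdealSheafData) (𝔟' : E'.IdealSheafData) (𝔟'' : E''.IdealSheafData) (C : E'.IdealSheafData)
    (h : IsWeightedSeq 2 ρ 𝔟 𝔟') (hC : Scheme.IsRegular C.subscheme) (hle : 𝔟' ≤ C) (hτ : IsBlowup τ C)
    (hctrl : 𝔟'.comap τ = C.comap τ * 𝔟'') : IsWeightedSeq 2 (τ ≫ ρ) 𝔟 𝔟'' :=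
  IsWeightedSeq.cons τ ρ 𝔟 𝔟' 𝔟'' C 1 h hC le_rfl one_le_two (by rwa [pow_one]) hτ (by rwa [pow_one])

/-- **PHASE A — CJS transport with weight one.** Modulo `CossartJannsenSaito2020EmbeddedSequenceB`: on an integral
Noetherian regular excellent scheme `E` of dimension three, a non-zero locally principal `𝔟` is carried by a weighted
sequence `π : Z₁ ⟶ E` with weights `≤ 2` (all equal to `1`) to an effective Cartier `𝔟₁ ≠ ⊥` on the integral
Noetherian REGULAR `Z₁`, whose support lies in a strict normal crossings divisor `B = X₁ ∪ B₁ = π⁻¹(Supp 𝔟)`.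
[cite: CossartJannsenSaito2020, Thm. 1.4, Cor. 1.5, Thm. 6.9 (a)] [cite: Kollar2007, (3.111) Step 3] -/
theorem phaseA (hCJS : CossartJannsenSaito2020EmbeddedSequenceB.{u})
    (E : Scheme.{u}) [IsIntegral E] [IsNoetherian E] (hreg : Scheme.IsRegular E)
    (hexc : Scheme.IsExcellent E) (hdim : topologicalKrullDim E = 3) (𝔟 : E.IdealSheafData)
    (h𝔟 : 𝔟 ≠ ⊥) (hlp : IsLocallyPrincipal 𝔟) :
    ∃ (Z₁ : Scheme.{u}) (π : Z₁ ⟶ E) (𝔟₁ : Z₁.IdealSheafData) (B : Set Z₁),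
      IsWeightedSeq 2 π 𝔟 𝔟₁ ∧ IsIntegral Z₁ ∧ IsNoetherian Z₁ ∧ Scheme.IsRegular Z₁ ∧
      IsEffectiveCartier 𝔟₁ ∧ 𝔟₁ ≠ ⊥ ∧ IsStrictNormalCrossingsDivisor Z₁ B ∧
      (𝔟₁.support : Set Z₁) ⊆ B := by
  have h𝔟c : IsEffectiveCartier 𝔟 := hlp.isEffectiveCartier_of_ne_bot h𝔟
  -- `X = Supp 𝔟` is closed, `≠ E`, of dimension `≤ 2`
  set X : Set E := (𝔟.support : Set E) with hXdef
  have hXc : IsClosed X := 𝔟.support.isClosed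
  have hXne : X ≠ Set.univ := fun hX =>
    not_mem_support_genericPoint h𝔟 (show genericPoint E ∈ X from hX ▸ Set.mem_univ _)
  have hdimX : topologicalKrullDim X ≤ 2 := by
    have hlt := Literature.Topology.topologicalKrullDim_lt_of_isClosed_ssubset hXc hXne (2 + 1)
      (by rw [hdim]; exact_mod_cast (by norm_num : (3 : ℕ) < 2 + 1 + 1))
    rw [Nat.cast_add_one] at hlt
    exact_mod_cast (ENat.WithBot.lt_add_one_iff.mp hlt)
  -- CJS: the `𝓑`-permissible sequence over `X`
  obtain ⟨Z₁, π, X₁, B₁, hT, hZ₁, -, -, -, -, hB₁, htot, htr⟩ :=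
    hCJS.of_isClosed E hreg hexc X hXc hdimX
  -- transport of the controlled transform, weight one, predicate `IsWeightedSeq 2`
  obtain ⟨hint, hnoeth, hcart, 𝔟', hP, h𝔟', h𝔟'ne, -, hsub⟩ :=
    DepthOneRegularize.transport (fun ⦃E' E : Scheme.{u}⦄ (ρ : E' ⟶ E) 𝔟 𝔟' => IsWeightedSeq 2 ρ 𝔟 𝔟')
      (fun E 𝔟 => IsWeightedSeq.nil 𝔟) isWeightedSeq_two_cons_one 𝔟 h𝔟c h𝔟 hT
  haveI := hint
  haveI := hnoeth
  have hX₁c : IsClosed X₁ := (hT.isEmbeddedTransform hXc).isClosed_transform hXc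
  -- `X₁ ∪ B₁ = Supp (𝔟𝒪_{Z₁})` is a strict normal crossings divisor
  have hcl : (⟨closure (X₁ ∪ B₁), isClosed_closure⟩ : Closeds Z₁) = (𝔟.comap π).support := by
    apply Closeds.ext
    change closure (X₁ ∪ B₁) = ((𝔟.comap π).support : Set Z₁)
    rw [(hX₁c.union hB₁.isClosed).closure_eq, support_comap, Closeds.coe_preimage, ← htot]
  have hsnc : IsStrictNormalCrossingsDivisor Z₁ (X₁ ∪ B₁) := by
    refine htr.isStrictNormalCrossingsDivisor_union hB₁ hX₁c fun x _ => ?_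
    obtain ⟨t, ht, hst⟩ := hcart.exists_stalkIdeal_eq_span x
    refine ⟨t, nonZeroDivisors.ne_zero ht, ?_⟩
    rw [hcl, vanishingIdeal_support, stalkIdeal_radical, hst]
  refine ⟨Z₁, π, 𝔟', X₁ ∪ B₁, hP, hint, hnoeth, hZ₁, h𝔟', h𝔟'ne, hsnc, fun y hy => ?_⟩
  rw [← htot]
  exact hsub hy

/-- **W₂ in two phases.** Modulo `CossartJannsenSaito2020EmbeddedSequenceB`: for `𝔟 ≠ ⊥` locally principal on an
integral Noetherian regular excellent scheme `E` of dimension three there are a weighted sequence `π : Z₁ ⟶ E` with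
weights `≤ 2` carrying `𝔟` to `𝔟₁ ≠ ⊥` on the integral Noetherian regular `Z₁` (Phase A), and a PURE weight-`2`
sequence `ρ : Z₂ ⟶ Z₁` carrying `𝔟₁` to `𝔟₂` of order `≤ 1` at every point (Phase B, `weightedCleanupSNC_holds 2` on
the strict normal crossings divisor `X₁ ∪ B₁`). [cite: CossartJannsenSaito2020, Thm. 1.4, Cor. 1.5]
[cite: Kollar2007, (3.111) Step 3] -/
theorem phases (hCJS : CossartJannsenSaito2020EmbeddedSequenceB.{u})
    (E : Scheme.{u}) [IsIntegral E] [IsNoetherian E] (hreg : Scheme.IsRegular E)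
    (hexc : Scheme.IsExcellent E) (hdim : topologicalKrullDim E = 3) (𝔟 : E.IdealSheafData)
    (h𝔟 : 𝔟 ≠ ⊥) (hlp : IsLocallyPrincipal 𝔟) :
    ∃ (Z₁ : Scheme.{u}) (π : Z₁ ⟶ E) (𝔟₁ : Z₁.IdealSheafData) (Z₂ : Scheme.{u}) (ρ : Z₂ ⟶ Z₁)
      (𝔟₂ : Z₂.IdealSheafData),
      IsWeightedSeq 2 π 𝔟 𝔟₁ ∧ IsIntegral Z₁ ∧ IsNoetherian Z₁ ∧ Scheme.IsRegular Z₁ ∧ 𝔟₁ ≠ ⊥ ∧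
      IsPureWeightedSeq 2 ρ 𝔟₁ 𝔟₂ ∧ ∀ x : Z₂, idealOrder 𝔟₂ x ≤ 1 := by
  obtain ⟨Z₁, π, 𝔟₁, B, hA, hint, hnoeth, hZ₁, h𝔟₁, h𝔟₁ne, hsnc, hsupp⟩ :=
    phaseA hCJS E hreg hexc hdim 𝔟 h𝔟 hlp
  haveI := hint
  haveI := hnoeth
  obtain ⟨Z₂, ρ, 𝔟₂, hB, hord⟩ :=
    weightedCleanupSNC_holds 2 one_le_two Z₁ hZ₁ B hsnc 𝔟₁ h𝔟₁ne h𝔟₁.isLocallyPrincipal hsupp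
  refine ⟨Z₁, π, 𝔟₁, Z₂, ρ, 𝔟₂, hA, hint, hnoeth, hZ₁, h𝔟₁ne, hB, fun x => ?_⟩
  exact ENat.lt_two_iff.mp (by exact_mod_cast hord x)

end DepthWeightTwo

namespace DepthTargets

/-- **TargetsF2 (b) by name — the weight-two trace theorem on regular excellent threefolds**: modulo CJS 2020
Thm. 1.4 with boundary (`CossartJannsenSaito2020EmbeddedSequenceB`, inside the statement), every non-zero locally
principal ideal sheaf on an integral Noetherian regular excellent scheme of dimension three is brought to order `≤ 1`
everywhere by a weighted sequence with weights `≤ 2` (Phase A weight one along the CJS sequence, Phase B pure weight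
two on the strict normal crossings divisor `X₁ ∪ B₁`), the top being integral, Noetherian and regular.
[cite: CossartJannsenSaito2020, Thm. 1.4, Cor. 1.5, Thm. 6.9 (a)] [cite: Kollar2007, (3.111) Step 3] -/
theorem weightTwoPrincipal₃_holds : WeightTwoPrincipal₃.{u} := by
  intro hCJS E _ _ hreg hexc hdim 𝔟 h𝔟 hlp
  obtain ⟨Z₁, π, 𝔟₁, Z₂, ρ, 𝔟₂, hA, hint, hnoeth, hZ₁, h𝔟₁ne, hB, hord⟩ :=
    DepthWeightTwo.phases hCJS E hreg hexc hdim 𝔟 h𝔟 hlp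
  haveI := hint
  haveI := hnoeth
  have hB' : IsWeightedSeq 2 ρ 𝔟₁ 𝔟₂ := hB.isWeightedSeq one_le_two
  exact ⟨Z₂, ρ ≫ π, 𝔟₂, IsWeightedSeq.append_pure one_le_two hB hA, hB'.isIntegral hZ₁ h𝔟₁ne,
    hB'.isNoetherian' hZ₁ h𝔟₁ne, hB'.isRegular hZ₁ h𝔟₁ne, hord⟩

end DepthTargets

end Summit.ResolutionOfSingularities.ResolutionOfSingularities.Theorems

end
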